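import Summits.Ventures.YMGap.RobustBall.LocalSourceScreeningStarDefect
import Summits.Ventures.YMGap.RobustBall.RobustStarDoorZdVariance
import HarnessLib

/-!
# Venture YMGap, track ROBUST-BALL (Y2) — the LINEAR-RESPONSE CURRENCY OF THE STAR DOOR `LinearResponseOnBallZdG`:
# a local source of STAR LOAD `B` moves a distant observable by at most `A · min(e^B − 1, 2) · e^{−m d}`, uniformly on the ball

HONEST FRAMING. WHAT THIS IS: a venture file (cell `pub-ymgap`, track Y2 ROBUST-BALL, seat rb-p1): the TYPED CURRENCY of the
linear-response estimate `LocalSourceScreeningStarDefect.abs_integral_sub_integral_le_of_source_star_defect_cylinder`: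

  `LinearResponseOnBallZdG d N β ε₀ ε₁ R m A` := for EVERY member `(W, supp)` of ds-2's gauge-invariant tier-1 ball
  `MemBallZdG ε₀ ε₁ R`, EVERY bounded adapted source `V` (listed by `suppV`) whose terms read only the links of a finite set `S`
  and whose one-link oscillation witnesses `oscV` have STAR LOAD at most `B ≥ 0` (`windowLoad d suppV oscV (vertexStarZd s) ≤ B`
  at every site `s`: the total oscillation the source puts on the `2d` links at a vertex — a LOCAL strength, uniform in the
  size of `S`), every DLR state `μ` of the member at 't Hooft coupling `β`, EVERY DLR state `ν` of `W + V` and every Lipschitz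
  cylinder observable `F` (`Λ`, `K_F`):  `|∫ F dμ − ∫ F dν| ≤ A · min(e^B − 1, 2) · e^{−m · d(Λ, S)} · #Λ · K_F`.

LINEAR in the source for small sources (`min(e^B − 1, 2) ≤ 2B`, `LinearResponseOnBallZdG.linear`), saturating at the
strength-free screening bound (`≤ 2A e^{−m d} #Λ K_F`) for large ones.  Nothing is asserted by the definition.  Bridges:
`linearResponseOnBallZdG_of_robustStar[_variance]` (ds-2's robust star door, modulus and variance forms, received sum `≤ ρ₀ < 1`):
`m = log(1/max(ρ₀,½))/(max R 1 + 4)`, `A = 4√N/(1 − max(ρ₀,½))`; the `SU(2)`, `d = 4` schema `su2_linearResponseOnBallZdG_star`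
and three SEGMENT cells on certificates already in the tree: ALL `0 ≤ β_W ≤ 1/8` on `MemBallZdG (37/500) (37/1000) R`:
`(m, A) = (log 2/(max R 1 + 4), 8√2)`; ALL `0 ≤ β_W ≤ 1/4` on `MemBallZdG (11/200) (11/400) R` (past the single-link threshold `2/9`):
`(log(4/3)/(max R 1 + 4), 16√2)`; ALL `0 ≤ β_W ≤ 1/3` on `MemBallZdG (3/125) (3/250) R`: `((1/400)/(max R 1 + 4), 1600√2)`; and the
WILSON POINTS: for `0 ≤ β_W ≤ 1/8` every bounded local modification of the `SU(2)` Wilson action on `ℤ⁴` with star load `B` moves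
every DLR expectation of every Lipschitz cylinder by at most `8√2 · min(e^B − 1, 2) · e^{−(log 2/5) d(Λ,S)} · #Λ · K_F`
(`su2_wilson_linearResponse_upTo_oneEighth`), and up to `β_W = 1/3` by `1600√2 · min(e^B − 1, 2) · e^{−((1/400)/5) d(Λ,S)} · #Λ · K_F`.
WHAT THIS IS NOT: `m` is a one-sided Dobrushin–Shlosman comparison rate in units of the door's locality radius; the constant
`1/(1 − ρ₀)` explodes at the frontier; lattice strong coupling only, nothing about the continuum limit or a Clay-sense mass gap.
-/

noncomputable section

open MeasureTheory Function Finset Real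
open scoped NNReal
open Literature.Probability.LatticeModels
open Literature.Probability.LatticeModels.DobrushinMetric (IsLipBound)
open Literature.MathematicalPhysics.QuantumLattice
open Literature.MathematicalPhysics.QuantumFieldTheory hiding ZdEdge Site
open Literature.MathematicalPhysics.QuantumFieldTheory.Balaban1983to89.StrongCouplingDobrushinWindow
  (OneLinkKRModulus)
open Summit.QuantumFields.BalabanUV.InfraRed.StrongCouplingPoincareDoorSUN (OneLinkPoincareSUN)
open Summit.QuantumFields.BalabanUV.InfraRed.StrongCouplingVarianceDoorSUN (OneLinkVarianceBound)
open Summit.Ventures.YMGap.DSWindowZd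
open Summit.Ventures.YMGap.StarResolventDim (Delta gaugeR doorPoly gaugeR_lt_one_of_door)

namespace Summit.Ventures.YMGap.RobustBall

variable {d N : ℕ}

variable (d N) in
/-- **THE LINEAR-RESPONSE CURRENCY OF THE STAR DOOR — a local source of star load `B` moves a distant observable by at most
`A · min(e^B − 1, 2) · e^{−m d}`, uniformly on the gauge-invariant tier-1 `ℤ^d` ball**: for every member `(W, supp)` of
`MemBallZdG ε₀ ε₁ R`, every bounded adapted source `V` listed by `suppV` whose terms read only the links of the finite set `S`,
with one-link oscillation witnesses `oscV` of star load `≤ B` at every site (`0 ≤ B`), every DLR state `μ` of the member at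
't Hooft coupling `β`, every DLR state `ν` of `W + V` (listed by `supp ∪ suppV`) and every Lipschitz cylinder observable `F`
(`Λ`, `K_F`): `|∫ F dμ − ∫ F dν| ≤ A · min(e^B − 1, 2) · e^{−m d(Λ,S)} · #Λ · K_F`.  Nothing is asserted by the definition. -/
def LinearResponseOnBallZdG (β ε₀ ε₁ : ℝ) (R : ℕ) (m A : ℝ) : Prop :=
  ∀ (W : Potential (ZdEdge d) (SUN N)) (supp : Finset (ZdEdge d) → Finset (Finset (ZdEdge d))),
    MemBallZdG ε₀ ε₁ R W supp →
  ∀ (V : Potential (ZdEdge d) (SUN N)), V.IsAdapted → (∀ X, ∃ C, ∀ U, |V X U| ≤ C) →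
  ∀ (suppV : Finset (ZdEdge d) → Finset (Finset (ZdEdge d))), V.IsSupportedBy suppV →
  ∀ (S : Finset (ZdEdge d)), (∀ X, DependsOn (V X) (↑S : Set (ZdEdge d))) →
  ∀ (oscV : Finset (ZdEdge d) → ZdEdge d → ℝ), (∀ X, Dobrushin.IsOscBound (V X) (oscV X)) →
  ∀ (B : ℝ), 0 ≤ B → (∀ s : Site d, windowLoad d suppV oscV (vertexStarZd s) ≤ B) →
  ∀ μ ∈ perturbedGibbsMeasures (d := d) (fundamentalRep (Fin N)) (N * β) W supp,
  ∀ ν ∈ perturbedGibbsMeasures (d := d) (fundamentalRep (Fin N)) (N * β) (W + V) (fun Λ => supp Λ ∪ suppV Λ),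
  ∀ (F : LGConfig d (SUN N) → ℝ) (Λ : Finset (ZdEdge d)) (KF : ℝ≥0),
    IsLipschitzCylinder (fundamentalRep (Fin N)) F Λ KF →
      |(∫ σ, F σ ∂μ) - ∫ σ, F σ ∂ν| ≤ A * min (exp B - 1) 2 * exp (-m * setDistEdges Λ S) * (Λ.card * KF)

/-- **Monotonicity**: smaller radii and range, a smaller rate and a larger constant are implied. -/
theorem LinearResponseOnBallZdG.mono {β ε₀ ε₁ ε₀' ε₁' m A m' A' : ℝ} {R R' : ℕ}
    (h : LinearResponseOnBallZdG d N β ε₀ ε₁ R m A) (h₀ : ε₀' ≤ ε₀) (h₁ : ε₁' ≤ ε₁) (hR : R' ≤ R)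
    (hm : m' ≤ m) (hA : A ≤ A') (hA0 : 0 ≤ A) : LinearResponseOnBallZdG d N β ε₀' ε₁' R' m' A' := by
  intro W supp hW V hV hVb suppV hsuppV S hVS oscV hoscV B hB0 hB μ hμ ν hν F Λ KF hF
  obtain ⟨osc, lip, hosc, hlip, hε₀, hε₁⟩ := hW.loads
  have hW' : MemBallZdG ε₀ ε₁ R W supp := ⟨hW.continuous, hW.dependsOn, hW.supportedBy,
    fun e X hX heX y hy => (hW.range e X hX heX y hy).trans (by exact_mod_cast hR), hW.gaugeInvariant, osc, lip,
    hosc, hlip, fun e => (hε₀ e).trans h₀, fun v => (hε₁ v).trans h₁⟩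
  have key := h W supp hW' V hV hVb suppV hsuppV S hVS oscV hoscV B hB0 hB μ hμ ν hν F Λ KF hF
  refine key.trans ?_
  have hmin : 0 ≤ min (exp B - 1) 2 := le_min (by linarith [add_one_le_exp B]) (by norm_num)
  have hexp : exp (-m * setDistEdges Λ S) ≤ exp (-m' * setDistEdges Λ S) :=
    exp_le_exp.2 (by nlinarith [setDistEdges_nonneg Λ S])
  have hΛK : (0 : ℝ) ≤ Λ.card * KF := by positivity
  have hA'0 : 0 ≤ A' * min (exp B - 1) 2 := mul_nonneg (hA0.trans hA) hmin
  calc A * min (exp B - 1) 2 * exp (-m * setDistEdges Λ S) * (Λ.card * KF)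
      ≤ A' * min (exp B - 1) 2 * exp (-m' * setDistEdges Λ S) * (Λ.card * KF) := by gcongr

/-- `min(e^B − 1, 2) ≤ 2B` for `B ≥ 0` (`|e^x − 1| ≤ 2|x|` on `|x| ≤ 1`; `2 ≤ 2B` beyond). -/
theorem min_exp_sub_one_two_le {B : ℝ} (hB : 0 ≤ B) : min (exp B - 1) 2 ≤ 2 * B := by
  rcases le_or_gt B 1 with h | h
  · have key := Real.abs_exp_sub_one_le (x := B) (by rwa [abs_of_nonneg hB])
    rw [abs_of_nonneg hB, abs_of_nonneg (by linarith [add_one_le_exp B])] at key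
    exact (min_le_left _ _).trans key
  · exact (min_le_right _ _).trans (by linarith)

/-- **THE LINEAR READING**: under the currency, a source of star load `B` moves `⟨F⟩` by at most
`2A · B · e^{−m d(Λ,S)} · #Λ · K_F`. -/
theorem LinearResponseOnBallZdG.linear {β ε₀ ε₁ m A : ℝ} {R : ℕ} (h : LinearResponseOnBallZdG d N β ε₀ ε₁ R m A)
    (hA0 : 0 ≤ A)
    {W : Potential (ZdEdge d) (SUN N)} {supp : Finset (ZdEdge d) → Finset (Finset (ZdEdge d))}
    (hW : MemBallZdG ε₀ ε₁ R W supp)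
    {V : Potential (ZdEdge d) (SUN N)} (hV : V.IsAdapted) (hVb : ∀ X, ∃ C, ∀ U, |V X U| ≤ C)
    {suppV : Finset (ZdEdge d) → Finset (Finset (ZdEdge d))} (hsuppV : V.IsSupportedBy suppV)
    {S : Finset (ZdEdge d)} (hVS : ∀ X, DependsOn (V X) (↑S : Set (ZdEdge d)))
    {oscV : Finset (ZdEdge d) → ZdEdge d → ℝ} (hoscV : ∀ X, Dobrushin.IsOscBound (V X) (oscV X))
    {B : ℝ} (hB0 : 0 ≤ B) (hB : ∀ s : Site d, windowLoad d suppV oscV (vertexStarZd s) ≤ B)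
    {μ ν : Measure (LGConfig d (SUN N))}
    (hμ : μ ∈ perturbedGibbsMeasures (d := d) (fundamentalRep (Fin N)) (N * β) W supp)
    (hν : ν ∈ perturbedGibbsMeasures (d := d) (fundamentalRep (Fin N)) (N * β) (W + V)
      (fun Λ => supp Λ ∪ suppV Λ))
    {F : LGConfig d (SUN N) → ℝ} {Λ : Finset (ZdEdge d)} {KF : ℝ≥0}
    (hF : IsLipschitzCylinder (fundamentalRep (Fin N)) F Λ KF) :
    |(∫ σ, F σ ∂μ) - ∫ σ, F σ ∂ν| ≤ 2 * A * B * exp (-m * setDistEdges Λ S) * (Λ.card * KF) := by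
  have key := h W supp hW V hV hVb suppV hsuppV S hVS oscV hoscV B hB0 hB μ hμ ν hν F Λ KF hF
  refine key.trans ?_
  have hΛK : (0 : ℝ) ≤ Λ.card * KF := by positivity
  have h1 := min_exp_sub_one_two_le hB0
  calc A * min (exp B - 1) 2 * exp (-m * setDistEdges Λ S) * (Λ.card * KF)
      ≤ A * (2 * B) * exp (-m * setDistEdges Λ S) * (Λ.card * KF) := by gcongr
    _ = 2 * A * B * exp (-m * setDistEdges Λ S) * (Λ.card * KF) := by ring

/-! ### The currency through ds-2's robust star door -/

/-- **LINEAR RESPONSE UNIFORMLY ON THE GAUGE-INVARIANT TIER-1 BALL THROUGH THE ROBUST STAR DOOR** (hypotheses of ds-2's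
`massGapOnBallZdG_of_robustStar`: a one-link Kantorovich–Rubinstein modulus; `ρ ≤ ρ₀ < 1`):
`LinearResponseOnBallZdG d N β ε₀ ε₁ R (log(1/max(ρ₀,½))/(max R 1 + 4)) (4√N/(1 − max(ρ₀,½)))`. -/
theorem linearResponseOnBallZdG_of_robustStar (hd : 2 ≤ d) (hN : 1 ≤ N) {β ε₀ ε₁ Rm K c lam θ ρ ρ₀ : ℝ}
    {R Kn : ℕ} (hK : 0 ≤ K) (hRm : |(N : ℝ) * β| / N * (2 * ((d : ℝ) - 1)) ≤ Rm) (hmod : OneLinkKRModulus N Rm K)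
    (hε₁ : 0 ≤ ε₁) (hc : K * Real.exp ε₀ * (1 + 2 * Real.sqrt N * ε₁) * (|(N : ℝ) * β| / N) ≤ c)
    (hlam : Real.sqrt N * ε₁ ≤ lam) (hθ : θ = (2 * (d : ℝ) - 2) * c + lam) (hθ1 : θ < 1)
    (hcd : doorPoly d c < 1) (hρ : ρ = gaugeR d c + (lam + θ ^ Kn * (4 * d * lam)) / (1 - θ)) (hρle : ρ ≤ ρ₀)
    (hρ1 : ρ₀ < 1) :
    LinearResponseOnBallZdG d N β ε₀ ε₁ R (-Real.log (max ρ₀ (1 / 2)) / (max R 1 + 4 : ℕ))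
      (4 * Real.sqrt N / (1 - max ρ₀ (1 / 2))) := by
  intro W supp hW V hV hVb suppV hsuppV S hVS oscV hoscV B hB0 hB μ hμ ν hν F Λ KF hF
  have hwin := (starWindowBoundZdR_of_memBallZdG hd hN hK hRm hmod hε₁ hc hlam hθ hθ1 hcd hρ hW).mono_rho hρle
  have hD : R + 2 ≤ max R 1 + 2 := by omega
  have key := abs_integral_sub_integral_le_of_source_star_defect_cylinder hW.continuous hW.dependsOn hW.supportedBy
    hW.range hD hρ1 hwin hV hVb hsuppV hVS hoscV hB0 (fun c => hB c.1) hμ hν hF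
  have e4 : (max R 1 + 2 + 2 : ℕ) = max R 1 + 4 := by omega
  rw [e4] at key
  calc |(∫ σ, F σ ∂μ) - ∫ σ, F σ ∂ν|
      ≤ 4 * Real.sqrt N * min (Real.exp B - 1) 2 / (1 - max ρ₀ (1 / 2)) *
          Real.exp (-(-Real.log (max ρ₀ (1 / 2)) / (max R 1 + 4 : ℕ)) * setDistEdges Λ S) * (Λ.card * KF) := key
    _ = 4 * Real.sqrt N / (1 - max ρ₀ (1 / 2)) * min (exp B - 1) 2 *
          exp (-(-Real.log (max ρ₀ (1 / 2)) / (max R 1 + 4 : ℕ)) * setDistEdges Λ S) * (Λ.card * KF) := by ring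

/-- **The same through the VARIANCE-FORM robust star door** (hypotheses of ds-2's `massGapOnBallZdG_of_robustStar_variance`:
a one-link Poincaré/variance pair `(c_P, v)`; `ρ ≤ ρ₀ < 1`). -/
theorem linearResponseOnBallZdG_of_robustStar_variance (hd : 2 ≤ d) (hN : 1 ≤ N) {β ε₀ ε₁ b cP v c lam θ ρ ρ₀ : ℝ}
    {R Kn : ℕ} (hcP : 0 ≤ cP) (hv : 0 ≤ v) (hb : |(N : ℝ) * β| / N * (2 * ((d : ℝ) - 1)) ≤ b) (hP : OneLinkPoincareSUN N b cP)
    (hVB : OneLinkVarianceBound N b v) (hε₁ : 0 ≤ ε₁) (hc : Real.exp ε₀ * Real.sqrt (cP * v) * (|(N : ℝ) * β| / N) ≤ c)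
    (hlam : Real.exp (ε₀ / 2) * Real.sqrt cP * ε₁ ≤ lam) (hθ : θ = (2 * (d : ℝ) - 2) * c + lam) (hθ1 : θ < 1)
    (hcd : doorPoly d c < 1) (hρ : ρ = gaugeR d c + (lam + θ ^ Kn * (4 * d * lam)) / (1 - θ)) (hρle : ρ ≤ ρ₀)
    (hρ1 : ρ₀ < 1) :
    LinearResponseOnBallZdG d N β ε₀ ε₁ R (-Real.log (max ρ₀ (1 / 2)) / (max R 1 + 4 : ℕ))
      (4 * Real.sqrt N / (1 - max ρ₀ (1 / 2))) := by
  intro W supp hW V hV hVb suppV hsuppV S hVS oscV hoscV B hB0 hB μ hμ ν hν F Λ KF hF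
  have hwin := (starWindowBoundZdR_of_memBallZdG_variance hd hN hcP hv hb hP hVB hε₁ hc hlam hθ hθ1 hcd hρ hW).mono_rho
    hρle
  have hD : R + 2 ≤ max R 1 + 2 := by omega
  have key := abs_integral_sub_integral_le_of_source_star_defect_cylinder hW.continuous hW.dependsOn hW.supportedBy
    hW.range hD hρ1 hwin hV hVb hsuppV hVS hoscV hB0 (fun c => hB c.1) hμ hν hF
  have e4 : (max R 1 + 2 + 2 : ℕ) = max R 1 + 4 := by omega
  rw [e4] at key
  calc |(∫ σ, F σ ∂μ) - ∫ σ, F σ ∂ν|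
      ≤ 4 * Real.sqrt N * min (Real.exp B - 1) 2 / (1 - max ρ₀ (1 / 2)) *
          Real.exp (-(-Real.log (max ρ₀ (1 / 2)) / (max R 1 + 4 : ℕ)) * setDistEdges Λ S) * (Λ.card * KF) := key
    _ = 4 * Real.sqrt N / (1 - max ρ₀ (1 / 2)) * min (exp B - 1) 2 *
          exp (-(-Real.log (max ρ₀ (1 / 2)) / (max R 1 + 4 : ℕ)) * setDistEdges Λ S) * (Λ.card * KF) := by ring

/-! ### `SU(2)`, `d = 4`: the schema on the quarter modulus and segment cells -/

/-- **SCHEMA, `SU(2)`, `d = 4`** (the hypotheses of `su2_uniformMassGapOnBallZdG_star`): decimal majorants `e^{ε₀} ≤ E`,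
`√2 ≤ S`, a coefficient `c ≥ E(1 + 2Sε₁)β_W/4`, `λ ≥ Sε₁`, the rational inequalities `doorPoly 4 c < 1`, `6c + λ < 1`,
`gaugeR 4 c + (λ + (6c+λ)^Kn·16λ)/(1 − (6c+λ)) ≤ ρ₀ < 1` ⇒
`LinearResponseOnBallZdG 4 2 (β_W/4) ε₀ ε₁ R (log(1/max(ρ₀,½))/(max R 1 + 4)) (4√2/(1 − max(ρ₀,½)))`. -/
theorem su2_linearResponseOnBallZdG_star (Kn : ℕ) {βW ε₀ ε₁ c lam E S ρ₀ : ℝ} (hβ0 : 0 ≤ βW) (hβ : βW ≤ 2 / 3)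
    (hε₁ : 0 ≤ ε₁) (hE : Real.exp ε₀ ≤ E) (hS : Real.sqrt 2 ≤ S) (hc : E * (1 + 2 * S * ε₁) * (βW / 4) ≤ c)
    (hlam : S * ε₁ ≤ lam) (hθ1 : 6 * c + lam < 1) (hcd : doorPoly 4 c < 1)
    (hρ0 : gaugeR 4 c + (lam + (6 * c + lam) ^ Kn * (16 * lam)) / (1 - (6 * c + lam)) ≤ ρ₀) (hρ1 : ρ₀ < 1)
    (R : ℕ) :
    LinearResponseOnBallZdG 4 2 (βW / 4) ε₀ ε₁ R (-Real.log (max ρ₀ (1 / 2)) / (max R 1 + 4 : ℕ))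
      (4 * Real.sqrt 2 / (1 - max ρ₀ (1 / 2))) := by
  -- adapted from `su2_localScreeningOnBallZdG_star`
  have hS0 : 0 ≤ S := (Real.sqrt_nonneg _).trans hS
  have hE0 : 0 ≤ E := (Real.exp_pos _).le.trans hE
  set θ : ℝ := 6 * c + lam with hθ
  set ρ : ℝ := gaugeR 4 c + (lam + θ ^ Kn * (16 * lam)) / (1 - θ) with hρ
  have habs : |((2 : ℕ) : ℝ) * (βW / 4)| / ((2 : ℕ) : ℝ) = βW / 4 := by
    rw [abs_of_nonneg (by positivity)]
    push_cast
    ring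
  have hR : |((2 : ℕ) : ℝ) * (βW / 4)| / ((2 : ℕ) : ℝ) * (2 * (((4 : ℕ) : ℝ) - 1)) ≤ 3 * βW / 2 := by
    rw [habs]; push_cast; linarith
  have hc' : (1 : ℝ) * Real.exp ε₀ * (1 + 2 * Real.sqrt ((2 : ℕ) : ℝ) * ε₁) *
      (|((2 : ℕ) : ℝ) * (βW / 4)| / ((2 : ℕ) : ℝ)) ≤ c := by
    refine le_trans ?_ hc
    have h1 : Real.sqrt ((2 : ℕ) : ℝ) = Real.sqrt 2 := by norm_num
    rw [h1, one_mul, habs]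
    have hb : 0 ≤ βW / 4 := by positivity
    calc Real.exp ε₀ * (1 + 2 * Real.sqrt 2 * ε₁) * (βW / 4) ≤ E * (1 + 2 * Real.sqrt 2 * ε₁) * (βW / 4) := by
          gcongr
      _ ≤ E * (1 + 2 * S * ε₁) * (βW / 4) := by gcongr
  have hlam' : Real.sqrt ((2 : ℕ) : ℝ) * ε₁ ≤ lam := by
    have h1 : Real.sqrt ((2 : ℕ) : ℝ) = Real.sqrt 2 := by norm_num
    rw [h1]; exact le_trans (mul_le_mul_of_nonneg_right hS hε₁) hlam
  have hθ' : θ = (2 * ((4 : ℕ) : ℝ) - 2) * c + lam := by rw [hθ]; push_cast; ring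
  have hρ' : ρ = gaugeR 4 c + (lam + θ ^ Kn * (4 * ((4 : ℕ) : ℝ) * lam)) / (1 - θ) := by rw [hρ]; push_cast; ring
  have h4 : (4 * Real.sqrt ((2 : ℕ) : ℝ) : ℝ) = 4 * Real.sqrt 2 := by norm_num
  rw [← h4]
  exact linearResponseOnBallZdG_of_robustStar (d := 4) (N := 2) (by norm_num) (by norm_num) zero_le_one hR
    (su2_quarterModulus hβ) hε₁ hc' hlam' hθ' hθ1 hcd hρ' hρ0 hρ1

/-- **SEGMENT CELL `0 ≤ β_W ≤ 1/8`, QUARTER RADIUS `(ε₀, ε₁) = (37/500, 37/1000)`**: received sum `≤ 7/20 ≤ 1/2` along the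
whole segment ⇒ `LinearResponseOnBallZdG 4 2 (β_W/4) (37/500) (37/1000) R (log 2/(max R 1 + 4)) (8√2)` — for EVERY member, every
local source of star load `B` and every DLR pair: `|∫ F dμ − ∫ F dν| ≤ 8√2 · min(e^B − 1, 2) · e^{−(log 2/(max R 1 + 4)) d(Λ,S)} · #Λ · K_F`
(certificate `c = 9293/250000`, `λ = 52327/1000000`, `E = T₄(37/500)` of the tree's `β_W = 1/8` cell). -/
theorem su2_linearResponseStar_upTo_oneEighth {βW : ℝ} (h0 : 0 ≤ βW) (h : βW ≤ 1 / 8) (R : ℕ) :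
    LinearResponseOnBallZdG 4 2 (βW / 4) (37 / 500) (37 / 1000) R (Real.log 2 / (max R 1 + 4 : ℕ)) (8 * Real.sqrt 2) := by
  have key := su2_linearResponseOnBallZdG_star 20 (ε₀ := 37 / 500) (ε₁ := 37 / 1000) (c := 9293 / 250000)
    (lam := 52327 / 1000000) (ρ₀ := 7 / 20) h0 (h.trans (by norm_num)) (by norm_num)
    (exp_le_taylor4 (x := 37 / 500) (by norm_num) (by norm_num)) sqrt_two_le ?_ (by norm_num) (by norm_num)
    (by unfold doorPoly; norm_num) (by unfold gaugeR Delta; norm_num) (by norm_num) R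
  · have hmax : max (7 / 20 : ℝ) (1 / 2) = 1 / 2 := by norm_num
    have hlog : -Real.log (max (7 / 20 : ℝ) (1 / 2)) = Real.log 2 := by
      rw [hmax, one_div, Real.log_inv, neg_neg]
    have hA : 4 * Real.sqrt 2 / (1 - max (7 / 20 : ℝ) (1 / 2)) = 8 * Real.sqrt 2 := by rw [hmax]; ring
    rw [hlog, hA] at key
    exact key
  · have hb : βW / 4 ≤ 1 / 32 := by linarith
    have hpos : (0 : ℝ) ≤ (1 + 37 / 500 + (37 / 500) ^ 2 / 2 + (37 / 500) ^ 3 / 6 + 5 / 96 * (37 / 500) ^ 4) *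
        (1 + 2 * 1.41422 * (37 / 1000)) := by norm_num
    calc (1 + 37 / 500 + (37 / 500) ^ 2 / 2 + (37 / 500) ^ 3 / 6 + 5 / 96 * (37 / 500) ^ 4 : ℝ) *
        (1 + 2 * 1.41422 * (37 / 1000)) * (βW / 4)
        ≤ (1 + 37 / 500 + (37 / 500) ^ 2 / 2 + (37 / 500) ^ 3 / 6 + 5 / 96 * (37 / 500) ^ 4 : ℝ) *
          (1 + 2 * 1.41422 * (37 / 1000)) * (1 / 32) := mul_le_mul_of_nonneg_left hb hpos
      _ ≤ 9293 / 250000 := by norm_num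

/-- **SEGMENT CELL `0 ≤ β_W ≤ 1/4`, HALF RADIUS `(ε₀, ε₁) = (11/200, 11/400)` — PAST THE SINGLE-LINK THRESHOLD `2/9`**:
received sum `≤ 3/4` ⇒ `LinearResponseOnBallZdG 4 2 (β_W/4) (11/200) (11/400) R (log(4/3)/(max R 1 + 4)) (16√2)`
(certificate `c = 71171/1000000`, `λ = 9723/250000` of the tree's `β_W = 1/4` cell). -/
theorem su2_linearResponseStar_upTo_oneQuarter {βW : ℝ} (h0 : 0 ≤ βW) (h : βW ≤ 1 / 4) (R : ℕ) :
    LinearResponseOnBallZdG 4 2 (βW / 4) (11 / 200) (11 / 400) R (Real.log (4 / 3) / (max R 1 + 4 : ℕ))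
      (16 * Real.sqrt 2) := by
  have key := su2_linearResponseOnBallZdG_star 20 (ε₀ := 11 / 200) (ε₁ := 11 / 400) (c := 71171 / 1000000)
    (lam := 9723 / 250000) (ρ₀ := 3 / 4) h0 (h.trans (by norm_num)) (by norm_num)
    (exp_le_taylor4 (x := 11 / 200) (by norm_num) (by norm_num)) sqrt_two_le ?_ (by norm_num) (by norm_num)
    (by unfold doorPoly; norm_num) (by unfold gaugeR Delta; norm_num) (by norm_num) R
  · have hmax : max (3 / 4 : ℝ) (1 / 2) = 3 / 4 := by norm_num
    have hlog : -Real.log (max (3 / 4 : ℝ) (1 / 2)) = Real.log (4 / 3) := by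
      rw [hmax, ← Real.log_inv]; norm_num
    have hA : 4 * Real.sqrt 2 / (1 - max (3 / 4 : ℝ) (1 / 2)) = 16 * Real.sqrt 2 := by rw [hmax]; ring
    rw [hlog, hA] at key
    exact key
  · have hb : βW / 4 ≤ 1 / 16 := by linarith
    have hpos : (0 : ℝ) ≤ (1 + 11 / 200 + (11 / 200) ^ 2 / 2 + (11 / 200) ^ 3 / 6 + 5 / 96 * (11 / 200) ^ 4) *
        (1 + 2 * 1.41422 * (11 / 400)) := by norm_num
    calc (1 + 11 / 200 + (11 / 200) ^ 2 / 2 + (11 / 200) ^ 3 / 6 + 5 / 96 * (11 / 200) ^ 4 : ℝ) *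
        (1 + 2 * 1.41422 * (11 / 400)) * (βW / 4)
        ≤ (1 + 11 / 200 + (11 / 200) ^ 2 / 2 + (11 / 200) ^ 3 / 6 + 5 / 96 * (11 / 200) ^ 4 : ℝ) *
          (1 + 2 * 1.41422 * (11 / 400)) * (1 / 16) := mul_le_mul_of_nonneg_left hb hpos
      _ ≤ 71171 / 1000000 := by norm_num

/-- **SEGMENT CELL `0 ≤ β_W ≤ 1/3` on `MemBallZdG (3/125) (3/250) R`**: received sum `≤ 399/400` ⇒
`LinearResponseOnBallZdG 4 2 (β_W/4) (3/125) (3/250) R ((1/400)/(max R 1 + 4)) (1600√2)` (the constant `4√2/(1 − ρ₀)` at the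
frontier certificate; rate `1 − ρ₀ ≤ log(1/ρ₀)`). -/
theorem su2_linearResponseStar_upTo_oneThird {βW : ℝ} (h0 : 0 ≤ βW) (h : βW ≤ 1 / 3) (R : ℕ) :
    LinearResponseOnBallZdG 4 2 (βW / 4) (3 / 125) (3 / 250) R ((1 / 400 : ℝ) / (max R 1 + 4 : ℕ))
      (1600 * Real.sqrt 2) := by
  have key := su2_linearResponseOnBallZdG_star 20 (ε₀ := 3 / 125) (ε₁ := 3 / 250) (c := 17651 / 200000)
    (lam := 16971 / 1000000) (E := 1024291 / 1000000) (S := 1.41422) (ρ₀ := 399 / 400) h0 (h.trans (by norm_num))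
    (by norm_num) exp_le_3_125_star sqrt_two_le ?_ (by norm_num) (by norm_num) (by unfold doorPoly; norm_num)
    (by unfold gaugeR Delta; norm_num) (by norm_num) R
  · have hmax : max (399 / 400 : ℝ) (1 / 2) = 399 / 400 := by norm_num
    have hA : 4 * Real.sqrt 2 / (1 - max (399 / 400 : ℝ) (1 / 2)) = 1600 * Real.sqrt 2 := by rw [hmax]; ring
    rw [hA] at key
    have hD : (0 : ℝ) < ((max R 1 + 4 : ℕ) : ℝ) := by positivity
    have hrate : (1 / 400 : ℝ) ≤ -Real.log (max (399 / 400 : ℝ) (1 / 2)) := by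
      rw [hmax]; have := Real.log_le_sub_one_of_pos (show (0 : ℝ) < 399 / 400 by norm_num); linarith
    exact key.mono le_rfl le_rfl le_rfl (div_le_div_of_nonneg_right hrate hD.le) le_rfl (by positivity)
  · have hb : βW / 4 ≤ 1 / 12 := by linarith
    have hpos : (0 : ℝ) ≤ 1024291 / 1000000 * (1 + 2 * 1.41422 * (3 / 250)) := by norm_num
    calc (1024291 / 1000000 : ℝ) * (1 + 2 * 1.41422 * (3 / 250)) * (βW / 4)
        ≤ 1024291 / 1000000 * (1 + 2 * 1.41422 * (3 / 250)) * (1 / 12) := mul_le_mul_of_nonneg_left hb hpos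
      _ ≤ 17651 / 200000 := by norm_num

/-! ### The Wilson points -/

/-- **THE WILSON POINT, `SU(2)` ON `ℤ⁴`, EVERY `0 ≤ β_W ≤ 1/8`: LINEAR RESPONSE TO EVERY BOUNDED LOCAL MODIFICATION, EXPLICITLY.**
For every `0 ≤ β_W ≤ 1/8`, every bounded adapted link potential `V` (listed by `suppV`) whose terms read only the links of a finite
set `S` and put oscillation load at most `B` on every vertex star (Wilson-loop insertions, couplings changed on a region, …), every
DLR state `μ` of `SU(2)` lattice Yang–Mills at `β_W` (tree coupling `β_W/2`), EVERY DLR state `ν` of the modified action and every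
Lipschitz cylinder `F`: `|∫ F dμ − ∫ F dν| ≤ 8√2 · min(e^B − 1, 2) · e^{−(log 2/5) d(Λ_F, S)} · #Λ_F · K_F`. -/
theorem su2_wilson_linearResponse_upTo_oneEighth {βW : ℝ} (h0 : 0 ≤ βW) (h1 : βW ≤ 1 / 8)
    {V : Potential (ZdEdge 4) (SUN 2)} (hV : V.IsAdapted) (hVb : ∀ X, ∃ C, ∀ U, |V X U| ≤ C)
    {suppV : Finset (ZdEdge 4) → Finset (Finset (ZdEdge 4))} (hsuppV : V.IsSupportedBy suppV)
    {S : Finset (ZdEdge 4)} (hVS : ∀ X, DependsOn (V X) (↑S : Set (ZdEdge 4)))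
    {oscV : Finset (ZdEdge 4) → ZdEdge 4 → ℝ} (hoscV : ∀ X, Dobrushin.IsOscBound (V X) (oscV X))
    {B : ℝ} (hB0 : 0 ≤ B) (hB : ∀ s : Site 4, windowLoad 4 suppV oscV (vertexStarZd s) ≤ B)
    {μ ν : Measure (LGConfig 4 (SUN 2))}
    (hμ : μ ∈ ymGibbsMeasures (d := 4) (fundamentalRep (Fin 2)) (2 * (βW / 4)))
    (hν : ν ∈ perturbedGibbsMeasures (d := 4) (fundamentalRep (Fin 2)) (2 * (βW / 4)) V suppV)
    {F : LGConfig 4 (SUN 2) → ℝ} {Λ : Finset (ZdEdge 4)} {KF : ℝ≥0}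
    (hF : IsLipschitzCylinder (fundamentalRep (Fin 2)) F Λ KF) :
    |(∫ σ, F σ ∂μ) - ∫ σ, F σ ∂ν| ≤
      8 * Real.sqrt 2 * min (exp B - 1) 2 * exp (-(Real.log 2 / 5) * setDistEdges Λ S) * (Λ.card * KF) := by
  have hball := su2_linearResponseStar_upTo_oneEighth h0 h1 0
  have e5 : ((max 0 1 + 4 : ℕ) : ℝ) = 5 := by norm_num
  rw [e5] at hball
  have hmem : MemBallZdG (N := 2) (d := 4) (37 / 500) (37 / 1000) 0 0 (fun _ => (∅ : Finset (Finset (ZdEdge 4)))) :=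
    memBallZdG_zero (by norm_num) (by norm_num) 0
  have hμ' : μ ∈ perturbedGibbsMeasures (d := 4) (fundamentalRep (Fin 2)) ((2 : ℕ) * (βW / 4))
      (0 : Potential (ZdEdge 4) (SUN 2)) (fun _ => ∅) := by
    rw [perturbedGibbsMeasures_zero]; exact_mod_cast hμ
  have hν' : ν ∈ perturbedGibbsMeasures (d := 4) (fundamentalRep (Fin 2)) ((2 : ℕ) * (βW / 4))
      ((0 : Potential (ZdEdge 4) (SUN 2)) + V)
      (fun Λ => (fun _ : Finset (ZdEdge 4) => (∅ : Finset (Finset (ZdEdge 4)))) Λ ∪ suppV Λ) := by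
    simpa only [zero_add, Finset.empty_union, Nat.cast_ofNat] using hν
  exact hball 0 _ hmem V hV hVb suppV hsuppV S hVS oscV hoscV B hB0 hB μ hμ' ν hν' F Λ KF hF

/-- **THE WILSON POINT UP TO `β_W = 1/3`**: for every `0 ≤ β_W ≤ 1/3` and the same data,
`|∫ F dμ − ∫ F dν| ≤ 1600√2 · min(e^B − 1, 2) · e^{−((1/400)/5) d(Λ_F, S)} · #Λ_F · K_F`. -/
theorem su2_wilson_linearResponse_upTo_oneThird {βW : ℝ} (h0 : 0 ≤ βW) (h1 : βW ≤ 1 / 3)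
    {V : Potential (ZdEdge 4) (SUN 2)} (hV : V.IsAdapted) (hVb : ∀ X, ∃ C, ∀ U, |V X U| ≤ C)
    {suppV : Finset (ZdEdge 4) → Finset (Finset (ZdEdge 4))} (hsuppV : V.IsSupportedBy suppV)
    {S : Finset (ZdEdge 4)} (hVS : ∀ X, DependsOn (V X) (↑S : Set (ZdEdge 4)))
    {oscV : Finset (ZdEdge 4) → ZdEdge 4 → ℝ} (hoscV : ∀ X, Dobrushin.IsOscBound (V X) (oscV X))
    {B : ℝ} (hB0 : 0 ≤ B) (hB : ∀ s : Site 4, windowLoad 4 suppV oscV (vertexStarZd s) ≤ B)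
    {μ ν : Measure (LGConfig 4 (SUN 2))}
    (hμ : μ ∈ ymGibbsMeasures (d := 4) (fundamentalRep (Fin 2)) (2 * (βW / 4)))
    (hν : ν ∈ perturbedGibbsMeasures (d := 4) (fundamentalRep (Fin 2)) (2 * (βW / 4)) V suppV)
    {F : LGConfig 4 (SUN 2) → ℝ} {Λ : Finset (ZdEdge 4)} {KF : ℝ≥0}
    (hF : IsLipschitzCylinder (fundamentalRep (Fin 2)) F Λ KF) :
    |(∫ σ, F σ ∂μ) - ∫ σ, F σ ∂ν| ≤
      1600 * Real.sqrt 2 * min (exp B - 1) 2 * exp (-((1 / 400 : ℝ) / 5) * setDistEdges Λ S) * (Λ.card * KF) := by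
  have hball := su2_linearResponseStar_upTo_oneThird h0 h1 0
  have e5 : ((max 0 1 + 4 : ℕ) : ℝ) = 5 := by norm_num
  rw [e5] at hball
  have hmem : MemBallZdG (N := 2) (d := 4) (3 / 125) (3 / 250) 0 0 (fun _ => (∅ : Finset (Finset (ZdEdge 4)))) :=
    memBallZdG_zero (by norm_num) (by norm_num) 0
  have hμ' : μ ∈ perturbedGibbsMeasures (d := 4) (fundamentalRep (Fin 2)) ((2 : ℕ) * (βW / 4))
      (0 : Potential (ZdEdge 4) (SUN 2)) (fun _ => ∅) := by
    rw [perturbedGibbsMeasures_zero]; exact_mod_cast hμ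
  have hν' : ν ∈ perturbedGibbsMeasures (d := 4) (fundamentalRep (Fin 2)) ((2 : ℕ) * (βW / 4))
      ((0 : Potential (ZdEdge 4) (SUN 2)) + V)
      (fun Λ => (fun _ : Finset (ZdEdge 4) => (∅ : Finset (Finset (ZdEdge 4)))) Λ ∪ suppV Λ) := by
    simpa only [zero_add, Finset.empty_union, Nat.cast_ofNat] using hν
  exact hball 0 _ hmem V hV hVb suppV hsuppV S hVS oscV hoscV B hB0 hB μ hμ' ν hν' F Λ KF hF

end Summit.Ventures.YMGap.RobustBall

end
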